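import Literature.MathematicalPhysics.QuantumFieldTheory.Balaban1983to89.B9Thm31SiteGpDecayReg335Y

/-!
# `Balaban1983to89.B9Thm31SiteGpDecayPar` — T. Bałaban, *Propagators for lattice gauge theories in a background field*, Commun. Math. Phys. **99** (1985)
# 389–434 [Balaban1985BackgroundPropagators] Thm 3.1 (3.46) p. 398 with (3.24) p. 394, by S. Agmon's positive-weight method [Agmon1982]: ★★★ **THE `L²`-LOCAL DECAY
# OF `G′(U) = Δ′_a(U)⁻¹` AT A GENERIC SITE TRANSPORTER `par`, FROM THREE DISPLAYED TRANSPORTER LAWS** — dag-n06-w1's `B9Thm31SiteGpDecayReg335Y` (at def-Y's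
# straight transporter `parSymY`, coercivity constant `1∕8` from the (3.35) class) RE-PRESSED ONCE over `par` with the legs' `G`-valuedness, the inverse-symmetry and a
# level-weighted coercivity of constant `κ` as HYPOTHESES (CASCADE-K: the knit certificate's site transporter is print's `parKnitY`, whose coercivity on (3.35) is
# this seat's `B9B8KnitLetterCoerciveReg335`, `κ = 1∕32`)

statement-level skeleton of published theorems with citation tags; proofs where landed; nothing here is a claim about the Yang–Mills mass gap

THE PRINT (p. 398).  (3.46): *«‖hG′(U)λ‖ ≤ B₀(Lʲη)(Lʲ′η)e^{−δ₀d(y,y′)}‖h‖‖λ‖ for supp h ⊂ Δ̃(y), y ∈ Λ_j, supp λ ⊂ Δ̃(y′)»*; the contours `Γ` of (3.19) p. 393 behind the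
averaging term of (3.24) are, in Sect. D's knit, [Balaban1985Averaging]'s averaged contour variables ((52)–(53) p. 26).

WHY THIS FILE (pub-ymgap fleet, director-ym №383 «CASCADE-K»; dag-n06-d g25 K3-D census «GENUINE KNIT ESTIMATE needed: (3.46) for `G′(parKnitY)` → `h46K`»).  The (3.46)₄
supplier chain of the N06 certificate (`B9Thm31SiteGpDecayReg335Y → …AgmonWeightY → …GpWeightedReg335Y → …AgmonExponentY → …GpGradDecayReg335Y → …GradGpDivDecayReg335Y →
B9Eq346GradGpDivTorusL2 → …AtPinsL2`) is written at `G′ = GpY i (parSymY i)`; its ONLY transporter-specific inputs are dag-n06-w1's coercivity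
`trIP_deltaPrimeAY_parSymY_ge_levelMass` (constant `1∕8` on def-Y's class (3.35)) and def-Y's `parSymY_mem ∕ parSymY_inv_symm` (+ the unit `isUnit_deltaPrimeAY_parSymY`,
a consequence).  THIS FILE is link 1 of the chain re-pressed at a GENERIC `par : SiteParY (M_N ℂ) i` with those inputs DISPLAYED: `hpar : ∀ z w, par U z w ∈ G`,
`hinv : ∀ z z′, par U z z′ = (par U z′ z)⁻¹`, `hcoer : ∀ Φ, κ·Σ_z (L^{lev z})⁻²·HS(Φ z) ≤ Re⟨Φ, Δ′_a(U; par)Φ⟩` (`0 < κ`); the class (3.35) and its thresholds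
`0 ≤ cMα₀`, `cMα₀(d+1) ≤ 1∕16` DISAPPEAR from the statements (they served only the parSymY coercivity; `U`'s `G`-valuedness is the hypothesis `hU`).  Constants: w1's
`1∕8 ↦ κ`, the weight budget `(d+1)θ_b + θ_s∕2 ≤ 1∕16 ↦ ≤ κ∕2`, the prefactor `256 = (1∕16)⁻² ↦ (κ∕2)⁻² = 4κ⁻²`.
* §1 ★ `isUnit_deltaPrimeAY_of_coer` (the unit from the coercivity, via w1's `isUnit_of_coercive`); ★★ `trIP_wsmul_deltaPrimeAY_winv_ge_levelMass_par` — the conjugated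
  coercivity `(κ − ((d+1)θ_b + θ_s∕2))·Σ_z m_z HS(Φ z) ≤ ⟨ωΦ, Δ′_a(U; par)(ω⁻¹Φ)⟩₁` (w1's file-5b identity `trIP_wsmul_deltaPrimeAY_winv_ge` is transporter-generic).
* §2 ★ `agmon_unpack_par` (the constant step with `c₁ ≤ c₀`, prefactor `(c₁²)⁻¹`), ★ `conj_wsmul_GpY_eq_pairing_par`, ★★ `levelMass_wsmul_GpY_le_pairing_par`, ★★
  `pairing_GpY_le_of_support_par`, ★★★ `hs_restrict_GpY_le_par`: `Σ_{z∈A} HS((G′(U; par)Ψ)(z)) ≤ 4κ⁻²·((L^{j_A})²(L^{j_B})²∕W²)·‖Ψ‖²₁` under w1's weight hypotheses with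
  the budget `(d+1)θ_b + θ_s∕2 ≤ κ∕2` — w1's proofs VERBATIM, the generic §2 bookkeeping (`trIP_wsq_eq_of_support ∕ abs_trIP_le_of_support ∕ sum_filter_hs_le_levelMass ∕
  agmon_arith(_pairing)`) imported BY NAME.
At `par := parSymY i`, `κ := 1∕8`, `hcoer := trIP_deltaPrimeAY_parSymY_ge_levelMass …` these are w1's statements (prefactor `4·64 = 256`).
HONEST SCOPE.  A decay estimate for one finite lattice operator at a time at a generic transporter, constants explicit, the three transporter laws displayed; NOT a
node discharge; count-neutral; nothing continuum ∕ OS ∕ mass gap ∕ Clay.  Cell `pub-ymgap` (D-0062), Track A node N06 [B9], seat `pub-ymgap-dag-n06-l` (g37), 2026-08-30;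
NEW file importing w1's file 6 only; nothing landed is modified.
-/

noncomputable section

namespace Literature.MathematicalPhysics.QuantumFieldTheory.Balaban1983to89.B9Thm31SiteGpDecayPar

open Literature.MathematicalPhysics.QuantumFieldTheory.Balaban1983to89
open Node00 B6KLevelCensusIndexV1 B6Geom246MultiLevelBox B6MultiLevelBoxOperator B6MultiLevelTorusOperator B6GlobalChartV1 B9BackgroundsKLevelV1
  B9Eq39Adjoint B9Thm311ReadingCoords B9Thm311DeltaPrimePos B9Ineq369CurvatureSmallAtLettersY B9Thm31SiteCoerciveGaugeBlockY
  B9Thm31SiteCoerciveReg335Y B9Thm31SiteGpBoundsReg335Y B9Thm31SitePolarisedFormY B9Thm31SiteConjugatedFormY B9Thm31SiteGpDecayReg335Y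
open Literature.MathematicalPhysics.QuantumFieldTheory.Balaban1983to89.B9Ineq349SiteAdjoint (trIP_comm)
open Literature.MathematicalPhysics.QuantumFieldTheory.Balaban1983to89.B9Thm311DeltaPrimeSymm (trIP_one_eq)
open Literature.MathematicalPhysics.QuantumFieldTheory.Balaban1983to89.B9Thm311FlippedBondLetters (hs_real_smul)
open scoped Matrix Matrix.Norms.L2Operator

variable {d ℓ : ℕ} {hd : 1 ≤ d + 1} {hL : Odd (ℓ + 1) ∧ 1 < ℓ + 1} {b₀ b₁ : ℝ}
variable (i : KIdx d ℓ hd hL b₀ b₁) {N : ℕ} {G : Subgroup (Matrix (Fin N) (Fin N) ℂ)ˣ} (par : SiteParY (Matrix (Fin N) (Fin N) ℂ) i)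

/-! ## §1 The unit and the conjugated coercivity at a generic transporter -/

/-- ★ the level-weighted coercivity of constant `κ > 0` makes `Δ′_a(U; par)` a UNIT (its `Ring.inverse` `G′ = GpY i par U` is the two-sided inverse): the uniform
form `κ·(L^k)⁻²‖Φ‖² ≤ Re⟨Φ, Δ′Φ⟩` and dag-n06-w1's `isUnit_of_coercive`. [cite: Balaban1985BackgroundPropagators, (3.25) p.395 («G′ = (Δ′_a)⁻¹»), Thm 3.11 p.416] -/
theorem isUnit_deltaPrimeAY_of_coer {U : CfgY (Matrix (Fin N) (Fin N) ℂ) i} {κ : ℝ} (hκ0 : 0 < κ)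
    (hcoer : ∀ Φ : SiteY i → Matrix (Fin N) (Fin N) ℂ,
      κ * ∑ z : SiteY i, (((((ℓ + 1) ^ (blkOf i.D.toDomains z).1.1 : ℕ) : ℝ)) ^ 2)⁻¹ * ∑ a, ∑ b, ‖Φ z a b‖ ^ 2 ≤ trIP (fun _ => (1 : ℝ)) Φ (deltaPrimeAY i par U Φ)) :
    IsUnit (deltaPrimeAY i par U) := by
  refine isUnit_of_coercive (w := fun _ => (1 : ℝ)) (fun _ => one_pos) (m := κ * (((((ℓ + 1) ^ i.k : ℕ) : ℝ)) ^ 2)⁻¹) (by positivity) fun Φ => ?_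
  refine le_trans ?_ (hcoer Φ)
  rw [trIP_one_self_eq, Finset.mul_sum, Finset.mul_sum]
  refine Finset.sum_le_sum fun z _ => ?_
  have hz0 : 0 ≤ ∑ a, ∑ b, ‖Φ z a b‖ ^ 2 := hs_nonneg _
  have hjk : (blkOf i.D.toDomains z).1.1 ≤ i.k := (scale_bounds i.D.toDomains _).2
  have hpow : (((ℓ + 1) ^ (blkOf i.D.toDomains z).1.1 : ℕ) : ℝ) ≤ (((ℓ + 1) ^ i.k : ℕ) : ℝ) := by
    exact_mod_cast Nat.pow_le_pow_right (Nat.succ_pos ℓ) hjk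
  have hpos : (0 : ℝ) < (((ℓ + 1) ^ (blkOf i.D.toDomains z).1.1 : ℕ) : ℝ) := by positivity
  have hinv : (((((ℓ + 1) ^ i.k : ℕ) : ℝ)) ^ 2)⁻¹ ≤ (((((ℓ + 1) ^ (blkOf i.D.toDomains z).1.1 : ℕ) : ℝ)) ^ 2)⁻¹ := by
    apply inv_anti₀ (by positivity)
    exact pow_le_pow_left₀ hpos.le hpow 2
  rw [mul_assoc]
  exact mul_le_mul_of_nonneg_left (mul_le_mul_of_nonneg_right hinv hz0) hκ0.le

/-- ★★ **THE CONJUGATED COERCIVITY OF `Δ′_a(U; par)` FROM THE LAWS**: `G ≤ U(N)`, `U` and the legs `G`-valued, the inverse-symmetry, the level-weighted coercivity of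
constant `κ`; a weight `ω > 0` with bond ratios `q ≤ θ_b·(L^{lev})⁻²` (both ends) and block oscillation `q ≤ θ_s`.  Then
`(κ − ((d+1)θ_b + θ_s∕2))·Σ_z (L^{lev z})⁻²·HS(Φ z) ≤ ⟨ωΦ, Δ′_a(U; par)(ω⁻¹Φ)⟩₁`. [cite: Agmon1982, Ch.1, Thm 1.5; Balaban1985BackgroundPropagators, Thm 3.1 p.397, (3.24) p.394] -/
theorem trIP_wsmul_deltaPrimeAY_winv_ge_levelMass_par [Nonempty (Fin N)] (hG : G ≤ B7Prop2Explicit.unitaryUnits (Matrix (Fin N) (Fin N) ℂ))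
    {U : CfgY (Matrix (Fin N) (Fin N) ℂ) i} (hU : ∀ μ x, U μ x ∈ G) (hpar : ∀ z w : SiteY i, par U z w ∈ G)
    (hinv : ∀ z z' : SiteY i, par U z z' = (par U z' z)⁻¹) {κ : ℝ}
    (hcoer : ∀ Φ : SiteY i → Matrix (Fin N) (Fin N) ℂ,
      κ * ∑ z : SiteY i, (((((ℓ + 1) ^ (blkOf i.D.toDomains z).1.1 : ℕ) : ℝ)) ^ 2)⁻¹ * ∑ a, ∑ b, ‖Φ z a b‖ ^ 2 ≤ trIP (fun _ => (1 : ℝ)) Φ (deltaPrimeAY i par U Φ))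
    {ω : SiteY i → ℝ} (hω : ∀ z, 0 < ω z) {θb θs : ℝ}
    (hb1 : ∀ μ z, ω (shiftY i μ z) / ω z + ω z / ω (shiftY i μ z) - 2 ≤ θb * (((((ℓ + 1) ^ (blkOf i.D.toDomains z).1.1 : ℕ) : ℝ)) ^ 2)⁻¹)
    (hb2 : ∀ μ z, ω (shiftY i μ z) / ω z + ω z / ω (shiftY i μ z) - 2 ≤ θb * (((((ℓ + 1) ^ (blkOf i.D.toDomains (shiftY i μ z)).1.1 : ℕ) : ℝ)) ^ 2)⁻¹)
    (hs : ∀ z w : SiteY i, blkOf i.D.toDomains w = blkOf i.D.toDomains z → ω z / ω w + ω w / ω z - 2 ≤ θs)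
    (Φ : SiteY i → Matrix (Fin N) (Fin N) ℂ) :
    (κ - (((d : ℝ) + 1) * θb + θs / 2)) * ∑ z : SiteY i, (((((ℓ + 1) ^ (blkOf i.D.toDomains z).1.1 : ℕ) : ℝ)) ^ 2)⁻¹ * ∑ a, ∑ b, ‖Φ z a b‖ ^ 2
      ≤ trIP (fun _ => (1 : ℝ)) (fun z => ((ω z : ℝ) : ℂ) • Φ z) (deltaPrimeAY i par U (fun z => (((ω z)⁻¹ : ℝ) : ℂ) • Φ z)) := by
  have h1 := hcoer Φ
  have h2 := trIP_wsmul_deltaPrimeAY_winv_ge i hG par U hinv hpar hU hω hb1 hb2 hs Φ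
  rw [sub_mul]
  linarith

/-! ## §2 Agmon's bound at a generic transporter -/

/-- unpacking the constants with a generic floor `0 < c₁ ≤ c₀`: `c₀²m_Am_BW²P_A ≤ Q ⇒ P_A ≤ (c₁²)⁻¹·(L_A²L_B²∕W²)·Q`. [cite: Agmon1982, Ch.1, bookkeeping] -/
theorem agmon_unpack_par {c₀ c₁ LA LB W PA Q : ℝ} (hc₁ : 0 < c₁) (hc₀ : c₁ ≤ c₀) (hLA : 0 < LA) (hLB : 0 < LB) (hW : 0 < W) (hQ : 0 ≤ Q)
    (h : c₀ ^ 2 * (LA ^ 2)⁻¹ * (LB ^ 2)⁻¹ * W ^ 2 * PA ≤ Q) : PA ≤ (c₁ ^ 2)⁻¹ * (LA ^ 2 * LB ^ 2 / W ^ 2) * Q := by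
  have hc₀0 : 0 < c₀ := lt_of_lt_of_le hc₁ hc₀
  have e : (c₀ ^ 2)⁻¹ * (LA ^ 2 * LB ^ 2 / W ^ 2) * (c₀ ^ 2 * (LA ^ 2)⁻¹ * (LB ^ 2)⁻¹ * W ^ 2 * PA) = PA := by
    field_simp
  have hkey : PA ≤ (c₀ ^ 2)⁻¹ * (LA ^ 2 * LB ^ 2 / W ^ 2) * Q := by
    calc PA = (c₀ ^ 2)⁻¹ * (LA ^ 2 * LB ^ 2 / W ^ 2) * (c₀ ^ 2 * (LA ^ 2)⁻¹ * (LB ^ 2)⁻¹ * W ^ 2 * PA) := e.symm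
      _ ≤ (c₀ ^ 2)⁻¹ * (LA ^ 2 * LB ^ 2 / W ^ 2) * Q := mul_le_mul_of_nonneg_left h (by positivity)
  have hc2 : (c₀ ^ 2)⁻¹ ≤ (c₁ ^ 2)⁻¹ := inv_anti₀ (by positivity) (pow_le_pow_left₀ hc₁.le hc₀ 2)
  exact hkey.trans (mul_le_mul_of_nonneg_right (mul_le_mul_of_nonneg_right hc2 (by positivity)) hQ)

/-- at `Φ = G′(U; par)Ψ` with `Ψ` supported where `ω = 1` and `Δ′_a(U; par)` a unit, THE CONJUGATED FORM OF `ωΦ` IS THE PLAIN PAIRING.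
[cite: Agmon1982, Ch.1; Balaban1985BackgroundPropagators, (3.25) p.395] -/
theorem conj_wsmul_GpY_eq_pairing_par {U : CfgY (Matrix (Fin N) (Fin N) ℂ) i} (hunit : IsUnit (deltaPrimeAY i par U))
    {ω : SiteY i → ℝ} (hω : ∀ z, 0 < ω z) {B : Finset (SiteY i)} {Ψ : SiteY i → Matrix (Fin N) (Fin N) ℂ}
    (hΨ : ∀ z, z ∉ B → Ψ z = 0) (hωB : ∀ z ∈ B, ω z = 1) :
    trIP (fun _ => (1 : ℝ)) (fun z => ((ω z : ℝ) : ℂ) • (((ω z : ℝ) : ℂ) • GpY i par U Ψ z))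
        (deltaPrimeAY i par U (fun z => (((ω z)⁻¹ : ℝ) : ℂ) • (((ω z : ℝ) : ℂ) • GpY i par U Ψ z)))
      = trIP (fun _ => (1 : ℝ)) (GpY i par U Ψ) Ψ := by
  have hinvΦ : (fun z => (((ω z)⁻¹ : ℝ) : ℂ) • (((ω z : ℝ) : ℂ) • GpY i par U Ψ z)) = GpY i par U Ψ := by
    funext z
    rw [smul_smul, ← Complex.ofReal_mul, inv_mul_cancel₀ (hω z).ne', Complex.ofReal_one, one_smul]
  have hΔΦ : deltaPrimeAY i par U (GpY i par U Ψ) = Ψ := apply_inverse_of_isUnit hunit Ψ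
  rw [hinvΦ, hΔΦ, trIP_wsq_eq_of_support i hωB hΨ]

/-- ★★ **AGMON'S FIRST READING AT A GENERIC TRANSPORTER**: for `Ψ` vanishing off `B`, a weight `ω > 0` with `ω = 1` on `B`, and `Φ := G′(U; par)Ψ`:
`(κ − (d+1)θ_b − θ_s∕2)·Σ_z m_z·HS(ω_z·Φ z) ≤ ⟨Φ, Ψ⟩₁`. [cite: Agmon1982, Ch.1, Thm 1.5; Balaban1985BackgroundPropagators, Thm 3.1 (3.46) p.398] -/
theorem levelMass_wsmul_GpY_le_pairing_par [Nonempty (Fin N)] (hG : G ≤ B7Prop2Explicit.unitaryUnits (Matrix (Fin N) (Fin N) ℂ))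
    {U : CfgY (Matrix (Fin N) (Fin N) ℂ) i} (hU : ∀ μ x, U μ x ∈ G) (hpar : ∀ z w : SiteY i, par U z w ∈ G)
    (hinv : ∀ z z' : SiteY i, par U z z' = (par U z' z)⁻¹) {κ : ℝ} (hκ0 : 0 < κ)
    (hcoer : ∀ Φ : SiteY i → Matrix (Fin N) (Fin N) ℂ,
      κ * ∑ z : SiteY i, (((((ℓ + 1) ^ (blkOf i.D.toDomains z).1.1 : ℕ) : ℝ)) ^ 2)⁻¹ * ∑ a, ∑ b, ‖Φ z a b‖ ^ 2 ≤ trIP (fun _ => (1 : ℝ)) Φ (deltaPrimeAY i par U Φ))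
    {ω : SiteY i → ℝ} (hω : ∀ z, 0 < ω z) {θb θs : ℝ}
    (hb1 : ∀ μ z, ω (shiftY i μ z) / ω z + ω z / ω (shiftY i μ z) - 2 ≤ θb * (((((ℓ + 1) ^ (blkOf i.D.toDomains z).1.1 : ℕ) : ℝ)) ^ 2)⁻¹)
    (hb2 : ∀ μ z, ω (shiftY i μ z) / ω z + ω z / ω (shiftY i μ z) - 2 ≤ θb * (((((ℓ + 1) ^ (blkOf i.D.toDomains (shiftY i μ z)).1.1 : ℕ) : ℝ)) ^ 2)⁻¹)
    (hs : ∀ z w : SiteY i, blkOf i.D.toDomains w = blkOf i.D.toDomains z → ω z / ω w + ω w / ω z - 2 ≤ θs)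
    {B : Finset (SiteY i)} {Ψ : SiteY i → Matrix (Fin N) (Fin N) ℂ} (hΨ : ∀ z, z ∉ B → Ψ z = 0) (hωB : ∀ z ∈ B, ω z = 1) :
    (κ - (((d : ℝ) + 1) * θb + θs / 2)) *
        ∑ z : SiteY i, (((((ℓ + 1) ^ (blkOf i.D.toDomains z).1.1 : ℕ) : ℝ)) ^ 2)⁻¹ * ∑ a, ∑ b, ‖(((ω z : ℝ) : ℂ) • GpY i par U Ψ z) a b‖ ^ 2
      ≤ trIP (fun _ => (1 : ℝ)) (GpY i par U Ψ) Ψ := by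
  have hconj := trIP_wsmul_deltaPrimeAY_winv_ge_levelMass_par i par hG hU hpar hinv hcoer hω hb1 hb2 hs (fun z => ((ω z : ℝ) : ℂ) • GpY i par U Ψ z)
  rwa [conj_wsmul_GpY_eq_pairing_par i par (isUnit_deltaPrimeAY_of_coer i par hκ0 hcoer) hω hΨ hωB] at hconj

/-- ★★ **AGMON'S SECOND READING AT A GENERIC TRANSPORTER**: under the same hypotheses, the budget `(d+1)θ_b + θ_s∕2 ≤ κ∕2` and levels `≤ j_B` on `B`:
`(κ − (d+1)θ_b − θ_s∕2)·(L^{j_B})⁻²·⟨G′(U; par)Ψ, Ψ⟩₁ ≤ ‖Ψ‖²₁`. [cite: Agmon1982, Ch.1, Thm 1.5; Balaban1985BackgroundPropagators, Thm 3.1 (3.46) p.398] -/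
theorem pairing_GpY_le_of_support_par [Nonempty (Fin N)] (hG : G ≤ B7Prop2Explicit.unitaryUnits (Matrix (Fin N) (Fin N) ℂ))
    {U : CfgY (Matrix (Fin N) (Fin N) ℂ) i} (hU : ∀ μ x, U μ x ∈ G) (hpar : ∀ z w : SiteY i, par U z w ∈ G)
    (hinv : ∀ z z' : SiteY i, par U z z' = (par U z' z)⁻¹) {κ : ℝ} (hκ0 : 0 < κ)
    (hcoer : ∀ Φ : SiteY i → Matrix (Fin N) (Fin N) ℂ,
      κ * ∑ z : SiteY i, (((((ℓ + 1) ^ (blkOf i.D.toDomains z).1.1 : ℕ) : ℝ)) ^ 2)⁻¹ * ∑ a, ∑ b, ‖Φ z a b‖ ^ 2 ≤ trIP (fun _ => (1 : ℝ)) Φ (deltaPrimeAY i par U Φ))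
    {ω : SiteY i → ℝ} (hω : ∀ z, 0 < ω z) {θb θs : ℝ}
    (hb1 : ∀ μ z, ω (shiftY i μ z) / ω z + ω z / ω (shiftY i μ z) - 2 ≤ θb * (((((ℓ + 1) ^ (blkOf i.D.toDomains z).1.1 : ℕ) : ℝ)) ^ 2)⁻¹)
    (hb2 : ∀ μ z, ω (shiftY i μ z) / ω z + ω z / ω (shiftY i μ z) - 2 ≤ θb * (((((ℓ + 1) ^ (blkOf i.D.toDomains (shiftY i μ z)).1.1 : ℕ) : ℝ)) ^ 2)⁻¹)
    (hs : ∀ z w : SiteY i, blkOf i.D.toDomains w = blkOf i.D.toDomains z → ω z / ω w + ω w / ω z - 2 ≤ θs)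
    (hκ : ((d : ℝ) + 1) * θb + θs / 2 ≤ κ / 2)
    {B : Finset (SiteY i)} {Ψ : SiteY i → Matrix (Fin N) (Fin N) ℂ} (hΨ : ∀ z, z ∉ B → Ψ z = 0) (hωB : ∀ z ∈ B, ω z = 1)
    {jB : ℕ} (hjB : ∀ z ∈ B, (blkOf i.D.toDomains z).1.1 ≤ jB) :
    (κ - (((d : ℝ) + 1) * θb + θs / 2)) * (((((ℓ + 1) ^ jB : ℕ) : ℝ)) ^ 2)⁻¹ * trIP (fun _ => (1 : ℝ)) (GpY i par U Ψ) Ψ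
      ≤ trIP (fun _ => (1 : ℝ)) Ψ Ψ := by
  have hc₀0 : 0 < κ - (((d : ℝ) + 1) * θb + θs / 2) := by linarith
  have hiX := levelMass_wsmul_GpY_le_pairing_par i par hG hU hpar hinv hκ0 hcoer hω hb1 hb2 hs hΨ hωB
  have hPB0 : 0 ≤ ∑ z ∈ B, ∑ a, ∑ b, ‖GpY i par U Ψ z a b‖ ^ 2 := Finset.sum_nonneg fun _ _ => hs_nonneg _
  have hQ0 : 0 ≤ trIP (fun _ => (1 : ℝ)) Ψ Ψ := trIP_self_nonneg _ (fun _ => one_pos) Ψ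
  have hX2 : trIP (fun _ => (1 : ℝ)) (GpY i par U Ψ) Ψ ^ 2
      ≤ (∑ z ∈ B, ∑ a, ∑ b, ‖GpY i par U Ψ z a b‖ ^ 2) * trIP (fun _ => (1 : ℝ)) Ψ Ψ := by
    have h := abs_trIP_le_of_support i hΨ (GpY i par U Ψ)
    calc trIP (fun _ => (1 : ℝ)) (GpY i par U Ψ) Ψ ^ 2 = |trIP (fun _ => (1 : ℝ)) (GpY i par U Ψ) Ψ| ^ 2 := (sq_abs _).symm
      _ ≤ (Real.sqrt (∑ z ∈ B, ∑ a, ∑ b, ‖GpY i par U Ψ z a b‖ ^ 2) * Real.sqrt (trIP (fun _ => (1 : ℝ)) Ψ Ψ)) ^ 2 :=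
          pow_le_pow_left₀ (abs_nonneg _) h 2
      _ = _ := by rw [mul_pow, Real.sq_sqrt hPB0, Real.sq_sqrt hQ0]
  have hMB := sum_filter_hs_le_levelMass i ω hjB zero_le_one (fun z hz => (hωB z hz).ge) (GpY i par U Ψ)
  rw [one_pow, mul_one] at hMB
  exact agmon_arith_pairing hc₀0 (inv_pos.2 (by positivity)) hPB0 hQ0 hiX hX2 hMB

/-- ★★★ **THE `L²`-LOCAL DECAY OF `G′(U; par)` FROM THE THREE TRANSPORTER LAWS — (3.46a)'s SHAPE BY AGMON'S METHOD.**  `G ≤ U(N)`, `N ≥ 1`, `U` and the legs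
`G`-valued, inverse-symmetry, level-weighted coercivity of constant `κ > 0`; finite site sets `A`, `B`; `Ψ` vanishing off `B`; a weight `ω > 0` with `ω = 1` on `B`,
`ω ≥ W > 0` on `A`, bond ratios `q(ω(z+e_μ), ω z) ≤ θ_b·(L^{lev})⁻²` (both ends), block oscillation `q ≤ θ_s`, budget `(d+1)θ_b + θ_s∕2 ≤ κ∕2`; levels `≤ j_A` on `A`,
`≤ j_B` on `B`.  THEN `Σ_{z∈A} HS((G′(U; par)Ψ)(z)) ≤ 4κ⁻²·((L^{j_A})²(L^{j_B})²∕W²)·‖Ψ‖²₁`.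
[cite: Balaban1985BackgroundPropagators, Thm 3.1 (3.46) p.398; Agmon1982, Ch.1, Thm 1.5; CombesThomas1973] -/
theorem hs_restrict_GpY_le_par [Nonempty (Fin N)] (hG : G ≤ B7Prop2Explicit.unitaryUnits (Matrix (Fin N) (Fin N) ℂ))
    {U : CfgY (Matrix (Fin N) (Fin N) ℂ) i} (hU : ∀ μ x, U μ x ∈ G) (hpar : ∀ z w : SiteY i, par U z w ∈ G)
    (hinv : ∀ z z' : SiteY i, par U z z' = (par U z' z)⁻¹) {κ : ℝ} (hκ0 : 0 < κ)
    (hcoer : ∀ Φ : SiteY i → Matrix (Fin N) (Fin N) ℂ,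
      κ * ∑ z : SiteY i, (((((ℓ + 1) ^ (blkOf i.D.toDomains z).1.1 : ℕ) : ℝ)) ^ 2)⁻¹ * ∑ a, ∑ b, ‖Φ z a b‖ ^ 2 ≤ trIP (fun _ => (1 : ℝ)) Φ (deltaPrimeAY i par U Φ))
    {ω : SiteY i → ℝ} (hω : ∀ z, 0 < ω z) {θb θs : ℝ}
    (hb1 : ∀ μ z, ω (shiftY i μ z) / ω z + ω z / ω (shiftY i μ z) - 2 ≤ θb * (((((ℓ + 1) ^ (blkOf i.D.toDomains z).1.1 : ℕ) : ℝ)) ^ 2)⁻¹)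
    (hb2 : ∀ μ z, ω (shiftY i μ z) / ω z + ω z / ω (shiftY i μ z) - 2 ≤ θb * (((((ℓ + 1) ^ (blkOf i.D.toDomains (shiftY i μ z)).1.1 : ℕ) : ℝ)) ^ 2)⁻¹)
    (hs : ∀ z w : SiteY i, blkOf i.D.toDomains w = blkOf i.D.toDomains z → ω z / ω w + ω w / ω z - 2 ≤ θs)
    (hκ : ((d : ℝ) + 1) * θb + θs / 2 ≤ κ / 2)
    {A B : Finset (SiteY i)} {Ψ : SiteY i → Matrix (Fin N) (Fin N) ℂ} (hΨ : ∀ z, z ∉ B → Ψ z = 0) (hωB : ∀ z ∈ B, ω z = 1)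
    {jA jB : ℕ} (hjA : ∀ z ∈ A, (blkOf i.D.toDomains z).1.1 ≤ jA) (hjB : ∀ z ∈ B, (blkOf i.D.toDomains z).1.1 ≤ jB)
    {W : ℝ} (hW0 : 0 < W) (hW : ∀ z ∈ A, W ≤ ω z) :
    ∑ z ∈ A, ∑ a, ∑ b, ‖GpY i par U Ψ z a b‖ ^ 2
      ≤ ((κ / 2) ^ 2)⁻¹ * (((((ℓ + 1) ^ jA : ℕ) : ℝ)) ^ 2 * ((((ℓ + 1) ^ jB : ℕ) : ℝ)) ^ 2 / W ^ 2) * trIP (fun _ => (1 : ℝ)) Ψ Ψ := by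
  have hc₀pos : κ / 2 ≤ κ - (((d : ℝ) + 1) * θb + θs / 2) := by linarith
  have hc₀0 : 0 < κ - (((d : ℝ) + 1) * θb + θs / 2) := lt_of_lt_of_le (by positivity) hc₀pos
  have hiX := levelMass_wsmul_GpY_le_pairing_par i par hG hU hpar hinv hκ0 hcoer hω hb1 hb2 hs hΨ hωB
  have hPB0 : 0 ≤ ∑ z ∈ B, ∑ a, ∑ b, ‖GpY i par U Ψ z a b‖ ^ 2 := Finset.sum_nonneg fun _ _ => hs_nonneg _
  have hQ0 : 0 ≤ trIP (fun _ => (1 : ℝ)) Ψ Ψ := trIP_self_nonneg _ (fun _ => one_pos) Ψ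
  have hX2 : trIP (fun _ => (1 : ℝ)) (GpY i par U Ψ) Ψ ^ 2
      ≤ (∑ z ∈ B, ∑ a, ∑ b, ‖GpY i par U Ψ z a b‖ ^ 2) * trIP (fun _ => (1 : ℝ)) Ψ Ψ := by
    have h := abs_trIP_le_of_support i hΨ (GpY i par U Ψ)
    calc trIP (fun _ => (1 : ℝ)) (GpY i par U Ψ) Ψ ^ 2 = |trIP (fun _ => (1 : ℝ)) (GpY i par U Ψ) Ψ| ^ 2 := (sq_abs _).symm
      _ ≤ (Real.sqrt (∑ z ∈ B, ∑ a, ∑ b, ‖GpY i par U Ψ z a b‖ ^ 2) * Real.sqrt (trIP (fun _ => (1 : ℝ)) Ψ Ψ)) ^ 2 :=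
          pow_le_pow_left₀ (abs_nonneg _) h 2
      _ = _ := by rw [mul_pow, Real.sq_sqrt hPB0, Real.sq_sqrt hQ0]
  have hMB := sum_filter_hs_le_levelMass i ω hjB zero_le_one (fun z hz => (hωB z hz).ge) (GpY i par U Ψ)
  rw [one_pow, mul_one] at hMB
  have hMA := sum_filter_hs_le_levelMass i ω hjA hW0.le hW (GpY i par U Ψ)
  have hfin := agmon_arith hc₀0 (inv_pos.2 (by positivity)) hPB0 hQ0 hiX hX2 hMB hMA
  exact agmon_unpack_par (by positivity) hc₀pos (by positivity) (by positivity) hW0 hQ0 hfin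

end Literature.MathematicalPhysics.QuantumFieldTheory.Balaban1983to89.B9Thm31SiteGpDecayPar

end
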